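import Summits.QuantumFields.GaugeBoot.PeriodicPairTerms
import Summits.QuantumFields.GaugeBoot.DiagonalRPTorusTubeTerms
import HarnessLib

/-!
# Links of a plaquette, lonely links and the centre twist on a periodic lattice (gauge-boot, L3 supplement: reduced-half in-plane mirrors, 2/7)

HONEST FRAMING (cell `pub-gaugeboot`, page 1 of every file): the venture produces certified bounds
on lattice expectations at stated coupling, gauge group, dimension and torus size; NOT a mass gap,
NOT a continuum limit, NOT a string tension; NOT Yang–Mills-summit-bearing (barriers
`FixedCouplingUltralocality`, `PerturbativeInvisibility`). This module is bookkeeping for a small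
structural NEGATIVE result (the REDUCED-half in-plane mirrors of the square tilted boxes are not of
positive type in `d ≥ 3` at small coupling); it discharges nothing by itself.

## Content (any finite periodic lattice `(A, e)` with `e k ≠ 0` for all `k`, compact metrisable `G`, continuous `ρ`)

The periodic-lattice version of the torus bookkeeping `DiagonalRPTorusTubeTerms.lean` §Links,
§Average, §Lonely, for the pair terms `pairT` of `PeriodicPairTerms.lean`:

* `plink e p a` (`a : Fin 4`) — the four links `(x,k)`, `(x+e_k,l)`, `(x+e_l,k)`, `(x,l)` of the
  plaquette `p = (x; k, l)` (the links entering `holonomy e U x k l`), `HasLink e p ℓ`,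
  `plaqObs_update_of_not_hasLink` (a plaquette does not read a link off it);
* `plink_injective` — the four links are distinct as soon as NO marked translation vanishes
  (`∀ k, e k ≠ 0`; on the tilted boxes: every side `≥ 2`), and **`holonomy_update_cases`**:
  updating one link of `p`, `U[ℓ ↦ s]_p = x s y` for all `s` or `= x s⁻¹ y` for all `s`;
* `exists_integral_gfac_update_eq` — the one-link average of a plaquette factor is a constant;
* ★ **`pairT_eq_mul_pairT_erase`** — THE LONELY-LINK REDUCTION `T_Q(u,v) = κ T_{Q∖q}(u,v)` when
  `q ∈ Q` has a link in no other plaquette of `Q` and in neither observable plaquette;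
* ★ **`pairT_eq_zero_of_uncovered_right/left`** — THE CENTRE TWIST: a link of an observable
  plaquette covered by no plaquette of `Q` (and not by the other observable) kills the term
  (`ρ z₀ = ω • 1`, `ω ≠ 1`, so `∫ Re tr ρ(x s y) ds = 0`; torus lemma
  `DiagRPTube.integral_reTr_mul_mul_eq_zero`);
* **`abs_pairT_sub_leading_le`** — the leading order of a pair term:
  `|T_Q(u,v) - β^{|Q|} ∫ W_u W_v ∏_{q ∈ Q} W_q| ≤ N² 2^{|Q|} (βN)^{|Q|+1}` (`W = Re tr ρ(U_·)`).

Elementary strong-coupling bookkeeping (cf. M. Creutz, *Quarks, gluons and lattices* (1983) §8–10);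
no definition of record, no named fact.
-/

noncomputable section

open MeasureTheory Finset Function
open Literature.MathematicalPhysics.QuantumFieldTheory (haarProbability)
open Literature.MathematicalPhysics.QuantumFieldTheory.PlaquetteLowerBound (reTr)
open Literature.RepresentationTheory.CompactGroups

namespace Summit.QuantumFields.GaugeBoot

namespace TiltedRP

namespace PairExp

/-! ## The four links of a plaquette -/

section Links

variable {A : Type*} [AddCommGroup A] {d : ℕ} (e : Fin d → A)

/-- The four links `(x,k)`, `(x+e_k,l)`, `(x+e_l,k)`, `(x,l)` of the plaquette `p = (x; k, l)`, in
the order in which `holonomy e U x k l = U(x,k) U(x+e_k,l) U(x+e_l,k)⁻¹ U(x,l)⁻¹` reads them.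
[folklore] -/
def plink (p : Plaq A d) : Fin 4 → Link A d
  | 0 => (p.1, p.2.1.1)
  | 1 => (p.1 + e p.2.1.1, p.2.1.2)
  | 2 => (p.1 + e p.2.1.2, p.2.1.1)
  | 3 => (p.1, p.2.1.2)

/-- `p` contains the link `ℓ`. [shape] A parametric definition of a proposition — NOT a fact.
[folklore] -/
def HasLink (p : Plaq A d) (ℓ : Link A d) : Prop := ∃ a : Fin 4, plink e p a = ℓ

/-- `HasLink` is decidable (for a decidable site group). [folklore] -/
instance instDecidableHasLink [DecidableEq A] (p : Plaq A d) (ℓ : Link A d) :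
    Decidable (HasLink e p ℓ) := by
  unfold HasLink; infer_instance

/-- The direction of a link of `p = (x; k, l)` is `k` or `l`. [folklore] -/
theorem plink_snd_eq_or (p : Plaq A d) (a : Fin 4) :
    (plink e p a).2 = p.2.1.1 ∨ (plink e p a).2 = p.2.1.2 := by
  fin_cases a <;> simp [plink]

/-- A link of `p` has one of the two directions of `p`. [folklore] -/
theorem HasLink.snd_eq_or {p : Plaq A d} {ℓ : Link A d} (h : HasLink e p ℓ) :
    ℓ.2 = p.2.1.1 ∨ ℓ.2 = p.2.1.2 := by
  obtain ⟨a, rfl⟩ := h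
  exact plink_snd_eq_or e p a

/-- **Membership, unfolded**: `ℓ` is a link of `(x; k, l)` iff it is one of `(x,k)`, `(x+e_k,l)`,
`(x+e_l,k)`, `(x,l)`. [folklore] -/
theorem hasLink_iff (p : Plaq A d) (ℓ : Link A d) :
    HasLink e p ℓ ↔ ℓ = (p.1, p.2.1.1) ∨ ℓ = (p.1 + e p.2.1.1, p.2.1.2) ∨
      ℓ = (p.1 + e p.2.1.2, p.2.1.1) ∨ ℓ = (p.1, p.2.1.2) := by
  constructor
  · rintro ⟨a, rfl⟩
    fin_cases a
    · exact Or.inl rfl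
    · exact Or.inr (Or.inl rfl)
    · exact Or.inr (Or.inr (Or.inl rfl))
    · exact Or.inr (Or.inr (Or.inr rfl))
  · rintro (rfl | rfl | rfl | rfl)
    · exact ⟨0, rfl⟩
    · exact ⟨1, rfl⟩
    · exact ⟨2, rfl⟩
    · exact ⟨3, rfl⟩

variable {G : Type*} [Group G]

/-- The plaquette observable reads only its four links. [folklore] -/
theorem plaqObs_congr_plink {N : ℕ} (ρ : G →* Matrix (Fin N) (Fin N) ℂ) (p : Plaq A d)
    {U V : Config A d G} (h : ∀ a : Fin 4, U (plink e p a) = V (plink e p a)) :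
    plaqObs ρ e p U = plaqObs ρ e p V := by
  unfold plaqObs
  rw [holonomy_congr e p.1 p.2.1.1 p.2.1.2 (h 0) (h 1) (h 2) (h 3)]

/-- **A plaquette does not read a link off it.** [folklore] -/
theorem plaqObs_update_of_not_hasLink [DecidableEq A] {N : ℕ} (ρ : G →* Matrix (Fin N) (Fin N) ℂ)
    (p : Plaq A d) {ℓ : Link A d} (hℓ : ¬ HasLink e p ℓ) (U : Config A d G) (s : G) :
    plaqObs ρ e p (update U ℓ s) = plaqObs ρ e p U :=
  plaqObs_congr_plink e ρ p fun a => update_of_ne (fun h => hℓ ⟨a, h⟩) _ _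

/-- A product of plaquette factors over plaquettes not containing `ℓ` does not read `ℓ`.
[folklore] -/
theorem prod_gfac_update_of_not_hasLink [DecidableEq A] {N : ℕ}
    (ρ : G →* Matrix (Fin N) (Fin N) ℂ) (β : ℝ) {Q : Finset (Plaq A d)} {ℓ : Link A d}
    (hQ : ∀ q ∈ Q, ¬ HasLink e q ℓ) (U : Config A d G) (s : G) :
    ∏ q ∈ Q, gfac ρ e β q (update U ℓ s) = ∏ q ∈ Q, gfac ρ e β q U :=
  prod_congr rfl fun q hq => by unfold gfac; rw [plaqObs_update_of_not_hasLink e ρ q (hQ q hq)]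

/-- **The four links of a plaquette are distinct** as soon as no marked translation vanishes.
[folklore] -/
theorem plink_injective (he : ∀ k, e k ≠ 0) (p : Plaq A d) : Function.Injective (plink e p) := by
  have hkl : p.2.1.1 ≠ p.2.1.2 := ne_of_lt p.2.2
  have h1 : p.1 + e p.2.1.1 ≠ p.1 := fun h => he _ (by simpa using h)
  have h2 : p.1 + e p.2.1.2 ≠ p.1 := fun h => he _ (by simpa using h)
  intro a b hab
  fin_cases a <;> fin_cases b
  all_goals first
    | rfl
    | (exfalso; simp only [plink, Prod.mk.injEq] at hab
       first
        | exact hkl hab.2 | exact hkl hab.2.symm | exact h1 hab.1 | exact h1 hab.1.symm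
        | exact h2 hab.1 | exact h2 hab.1.symm)

/-- **Updating one link of a plaquette**: for a link `ℓ` of `p`, uniformly in `U`, either
`U[ℓ ↦ s]_p = x s y` for all `s` or `U[ℓ ↦ s]_p = x s⁻¹ y` for all `s` (`x, y` depending on `U`
only). [folklore] -/
theorem holonomy_update_cases [DecidableEq A] (he : ∀ k, e k ≠ 0) (p : Plaq A d) {ℓ : Link A d}
    (hℓ : HasLink e p ℓ) :
    (∀ U : Config A d G, ∃ x y : G, ∀ s : G,
        holonomy e (update U ℓ s) p.1 p.2.1.1 p.2.1.2 = x * s * y) ∨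
      (∀ U : Config A d G, ∃ x y : G, ∀ s : G,
        holonomy e (update U ℓ s) p.1 p.2.1.1 p.2.1.2 = x * s⁻¹ * y) := by
  have hinj := plink_injective e he p
  have hne : ∀ a b : Fin 4, a ≠ b → plink e p a ≠ plink e p b := fun a b h h' => h (hinj h')
  obtain ⟨a, rfl⟩ := hℓ
  unfold holonomy
  rw [show (p.1, p.2.1.1) = plink e p 0 from rfl, show (p.1 + e p.2.1.1, p.2.1.2) = plink e p 1 from rfl,
    show (p.1 + e p.2.1.2, p.2.1.1) = plink e p 2 from rfl, show (p.1, p.2.1.2) = plink e p 3 from rfl]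
  have h4 : a = 0 ∨ a = 1 ∨ a = 2 ∨ a = 3 := by fin_cases a <;> simp
  rcases h4 with rfl | rfl | rfl | rfl
  · refine Or.inl fun U => ⟨1, U (plink e p 1) * (U (plink e p 2))⁻¹ * (U (plink e p 3))⁻¹, fun s => ?_⟩
    rw [update_self, update_of_ne (hne 1 0 (by decide)), update_of_ne (hne 2 0 (by decide)),
      update_of_ne (hne 3 0 (by decide))]
    group
  · refine Or.inl fun U => ⟨U (plink e p 0), (U (plink e p 2))⁻¹ * (U (plink e p 3))⁻¹, fun s => ?_⟩
    rw [update_self, update_of_ne (hne 0 1 (by decide)), update_of_ne (hne 2 1 (by decide)),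
      update_of_ne (hne 3 1 (by decide))]
    group
  · refine Or.inr fun U => ⟨U (plink e p 0) * U (plink e p 1), (U (plink e p 3))⁻¹, fun s => ?_⟩
    rw [update_self, update_of_ne (hne 0 2 (by decide)), update_of_ne (hne 1 2 (by decide)),
      update_of_ne (hne 3 2 (by decide))]
  · refine Or.inr fun U => ⟨U (plink e p 0) * U (plink e p 1) * (U (plink e p 2))⁻¹, 1, fun s => ?_⟩
    rw [update_self, update_of_ne (hne 0 3 (by decide)), update_of_ne (hne 1 3 (by decide)),
      update_of_ne (hne 2 3 (by decide)), mul_one]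

end Links

/-! ## One-link averages -/

section Average

variable {A : Type*} [AddCommGroup A] [Fintype A] [DecidableEq A] {d N : ℕ} {G : Type*} [Group G]
  [TopologicalSpace G] [IsTopologicalGroup G] [CompactSpace G] [MeasurableSpace G] [BorelSpace G]
  [SecondCountableTopology G] (ρ : G →* Matrix (Fin N) (Fin N) ℂ) (e : Fin d → A) (β : ℝ)

omit [Fintype A] [DecidableEq A] [TopologicalSpace G] [IsTopologicalGroup G] [CompactSpace G]
  [MeasurableSpace G] [BorelSpace G] [SecondCountableTopology G] in
/-- `Re tr ρ(U_p) = reTr ρ (holonomy)` (definitional bridge to the torus vocabulary). [folklore] -/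
theorem plaqObs_eq_reTr (p : Plaq A d) (U : Config A d G) :
    plaqObs ρ e p U = reTr ρ (holonomy e U p.1 p.2.1.1 p.2.1.2) := rfl

omit [Fintype A] [SecondCountableTopology G] in
/-- **The one-link average of a plaquette factor is a constant**: for a link `ℓ` of `q` there is
`κ ∈ ℝ` with `∫ g_q(U[ℓ ↦ s]) ds = κ` for EVERY configuration `U`. [folklore] -/
theorem exists_integral_gfac_update_eq (he : ∀ k, e k ≠ 0) (q : Plaq A d) {ℓ : Link A d}
    (hℓ : HasLink e q ℓ) :
    ∃ κ : ℝ, ∀ U : Config A d G, ∫ s, gfac ρ e β q (update U ℓ s) ∂haarProbability G = κ := by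
  have hg : ∀ V : Config A d G, gfac ρ e β q V =
      (fun r : ℝ => Real.exp (β * r) - 1) (reTr ρ (holonomy e V q.1 q.2.1.1 q.2.1.2)) :=
    fun V => rfl
  rcases holonomy_update_cases e (G := G) he q hℓ with h | h
  · refine ⟨∫ s, (Real.exp (β * reTr ρ s) - 1) ∂haarProbability G, fun U => ?_⟩
    obtain ⟨x, y, hxy⟩ := h U
    simp_rw [hg, hxy]
    exact DiagRPSUN.integral_comp_reTr_mul_mul ρ (fun r => Real.exp (β * r) - 1) x y
  · refine ⟨∫ s, (Real.exp (β * reTr ρ s⁻¹) - 1) ∂haarProbability G, fun U => ?_⟩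
    obtain ⟨x, y, hxy⟩ := h U
    simp_rw [hg, hxy]
    exact DiagRPSUN.integral_comp_reTr_mul_inv_mul ρ (fun r => Real.exp (β * r) - 1) x y

omit [Fintype A] [SecondCountableTopology G] in
/-- **The one-link average of an observable plaquette VANISHES under the centre twist**
(`ρ z₀ = ω • 1`, `ω ≠ 1`): for a link `ℓ` of `v`, `∫ Re tr ρ(U[ℓ ↦ s]_v) ds = 0` for every `U`.
[folklore] -/
theorem integral_plaqObs_update_eq_zero (he : ∀ k, e k ≠ 0) (hρ : Continuous ρ) {z₀ : G} {ω : ℂ}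
    (hz₀ : ρ z₀ = ω • (1 : Matrix (Fin N) (Fin N) ℂ)) (hω : ω ≠ 1) (v : Plaq A d) {ℓ : Link A d}
    (hℓ : HasLink e v ℓ) (U : Config A d G) :
    ∫ s, plaqObs ρ e v (update U ℓ s) ∂haarProbability G = 0 := by
  simp_rw [plaqObs_eq_reTr]
  rcases holonomy_update_cases e (G := G) he v hℓ with h | h
  · obtain ⟨x, y, hxy⟩ := h U
    simp_rw [hxy]
    exact DiagRPTube.integral_reTr_mul_mul_eq_zero ρ hρ hz₀ hω x y
  · obtain ⟨x, y, hxy⟩ := h U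
    simp_rw [hxy]
    exact DiagRPTube.integral_reTr_mul_inv_mul_eq_zero ρ hρ hz₀ hω x y

end Average

/-! ## The lonely-link reduction and the vanishing of uncovered terms -/

section Lonely

variable {A : Type*} [AddCommGroup A] [Fintype A] [DecidableEq A] {d N : ℕ} {G : Type*} [Group G]
  [TopologicalSpace G] [IsTopologicalGroup G] [CompactSpace G] [MeasurableSpace G] [BorelSpace G]
  [SecondCountableTopology G] (ρ : G →* Matrix (Fin N) (Fin N) ℂ) (e : Fin d → A) (β : ℝ)

/-- ★ **The lonely-link reduction.** Let `q ∈ Q` have a link `ℓ` lying in no other plaquette of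
`Q` and in neither observable plaquette `u, v`. Then `T_Q(u,v) = κ T_{Q∖{q}}(u,v)` for a real
constant `κ`. [folklore] -/
theorem pairT_eq_mul_pairT_erase (he : ∀ k, e k ≠ 0) (hρ : Continuous ρ) {Q : Finset (Plaq A d)}
    {q : Plaq A d} (hq : q ∈ Q) {ℓ : Link A d} (hℓ : HasLink e q ℓ)
    (hlone : ∀ q' ∈ Q, q' ≠ q → ¬ HasLink e q' ℓ) {u v : Plaq A d} (hu : ¬ HasLink e u ℓ)
    (hv : ¬ HasLink e v ℓ) :
    ∃ κ : ℝ, pairT ρ e β Q u v = κ * pairT ρ e β (Q.erase q) u v := by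
  obtain ⟨κ, hκ⟩ := exists_integral_gfac_update_eq ρ e β (G := G) he q hℓ
  refine ⟨κ, ?_⟩
  unfold pairT productHaar
  rw [← integral_const_mul]
  refine DiagRPSUN.integral_pi_update_of_forall (haarProbability G) ℓ
    (TwistedSlab.integrable_config_of_continuous (continuous_pairIntegrand ρ e β hρ Q u v)) fun U => ?_
  have hsplit : ∀ V : Config A d G, ∏ q' ∈ Q, gfac ρ e β q' V =
      gfac ρ e β q V * ∏ q' ∈ Q.erase q, gfac ρ e β q' V := fun V => (mul_prod_erase Q _ hq).symm
  have hrest : ∀ s : G, ∏ q' ∈ Q.erase q, gfac ρ e β q' (update U ℓ s) =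
      ∏ q' ∈ Q.erase q, gfac ρ e β q' U := fun s =>
    prod_gfac_update_of_not_hasLink e ρ β (fun q' hq' => hlone q' (mem_of_mem_erase hq')
      (ne_of_mem_erase hq')) U s
  have hF : ∀ s : G, plaqObs ρ e u (update U ℓ s) * plaqObs ρ e v (update U ℓ s) *
      ∏ q' ∈ Q, gfac ρ e β q' (update U ℓ s) =
      (plaqObs ρ e u U * plaqObs ρ e v U * ∏ q' ∈ Q.erase q, gfac ρ e β q' U) *
        gfac ρ e β q (update U ℓ s) := fun s => by
    rw [plaqObs_update_of_not_hasLink e ρ u hu, plaqObs_update_of_not_hasLink e ρ v hv, hsplit, hrest]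
    ring
  simp_rw [hF]
  rw [integral_const_mul, hκ U]
  ring

/-- ★ **An uncovered link of the right observable kills the term** (centre twist): if a link `ℓ`
of `v` lies in no plaquette of `Q` and not in `u`, then `T_Q(u,v) = 0`. [folklore] -/
theorem pairT_eq_zero_of_uncovered_right (he : ∀ k, e k ≠ 0) (hρ : Continuous ρ) {z₀ : G} {ω : ℂ}
    (hz₀ : ρ z₀ = ω • (1 : Matrix (Fin N) (Fin N) ℂ)) (hω : ω ≠ 1) {Q : Finset (Plaq A d)}
    {u v : Plaq A d} {ℓ : Link A d} (hv : HasLink e v ℓ) (hu : ¬ HasLink e u ℓ)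
    (hQ : ∀ q ∈ Q, ¬ HasLink e q ℓ) : pairT ρ e β Q u v = 0 := by
  unfold pairT productHaar
  rw [← integral_zero (α := Config A d G)]
  refine DiagRPSUN.integral_pi_update_of_forall (haarProbability G) ℓ
    (TwistedSlab.integrable_config_of_continuous (continuous_pairIntegrand ρ e β hρ Q u v)) fun U => ?_
  have hF : ∀ s : G, plaqObs ρ e u (update U ℓ s) * plaqObs ρ e v (update U ℓ s) *
      ∏ q ∈ Q, gfac ρ e β q (update U ℓ s) =
      (plaqObs ρ e u U * ∏ q ∈ Q, gfac ρ e β q U) * plaqObs ρ e v (update U ℓ s) :=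
    fun s => by rw [plaqObs_update_of_not_hasLink e ρ u hu, prod_gfac_update_of_not_hasLink e ρ β hQ]; ring
  simp_rw [hF]
  rw [integral_const_mul, integral_plaqObs_update_eq_zero ρ e he hρ hz₀ hω v hv U, mul_zero]

/-- ★ **An uncovered link of the left observable kills the term.** [folklore] -/
theorem pairT_eq_zero_of_uncovered_left (he : ∀ k, e k ≠ 0) (hρ : Continuous ρ) {z₀ : G} {ω : ℂ}
    (hz₀ : ρ z₀ = ω • (1 : Matrix (Fin N) (Fin N) ℂ)) (hω : ω ≠ 1) {Q : Finset (Plaq A d)}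
    {u v : Plaq A d} {ℓ : Link A d} (hu : HasLink e u ℓ) (hv : ¬ HasLink e v ℓ)
    (hQ : ∀ q ∈ Q, ¬ HasLink e q ℓ) : pairT ρ e β Q u v = 0 := by
  rw [pairT_comm, pairT_eq_zero_of_uncovered_right ρ e β he hρ hz₀ hω hu hv hQ]

/-- **Lonely link, then uncovered**: if `q ∈ Q` has a lonely link `ℓ` (in no other plaquette of
`Q`, not in `u`, `v`) and, once `q` is removed, some link `ℓ'` of `v` is covered by nothing
(`ℓ'` not in `u`, in no plaquette of `Q` other than `q`), then `T_Q(u,v) = 0`. [folklore] -/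
theorem pairT_eq_zero_of_lonely_of_uncovered (he : ∀ k, e k ≠ 0) (hρ : Continuous ρ) {z₀ : G}
    {ω : ℂ} (hz₀ : ρ z₀ = ω • (1 : Matrix (Fin N) (Fin N) ℂ)) (hω : ω ≠ 1)
    {Q : Finset (Plaq A d)} {q : Plaq A d} (hq : q ∈ Q) {ℓ : Link A d} (hℓ : HasLink e q ℓ)
    (hlone : ∀ q' ∈ Q, q' ≠ q → ¬ HasLink e q' ℓ) {u v : Plaq A d} (hu : ¬ HasLink e u ℓ)
    (hv : ¬ HasLink e v ℓ) {ℓ' : Link A d} (hv' : HasLink e v ℓ') (hu' : ¬ HasLink e u ℓ')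
    (hQ' : ∀ q' ∈ Q, q' ≠ q → ¬ HasLink e q' ℓ') : pairT ρ e β Q u v = 0 := by
  obtain ⟨κ, hκ⟩ := pairT_eq_mul_pairT_erase ρ e β he hρ hq hℓ hlone hu hv
  rw [hκ, pairT_eq_zero_of_uncovered_right ρ e β he hρ hz₀ hω hv' hu'
    (fun q' hq' => hQ' q' (mem_of_mem_erase hq') (ne_of_mem_erase hq')), mul_zero]

end Lonely

/-! ## The leading order of a pair term -/

section Leading

variable {A : Type*} [AddCommGroup A] [Fintype A] {d N : ℕ} {G : Type*} [Group G]
  [TopologicalSpace G] [IsTopologicalGroup G] [CompactSpace G] [MeasurableSpace G] [BorelSpace G]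
  [SecondCountableTopology G] (ρ : G →* Matrix (Fin N) (Fin N) ℂ) (e : Fin d → A) (β : ℝ)

/-- The leading moment `M_Q(u,v) = ∫ W_u W_v ∏_{q ∈ Q} W_q ∏ dU` (`W = Re tr ρ(U_·)`), a real
product-Haar integral independent of `β`. [folklore] -/
def leadM (Q : Finset (Plaq A d)) (u v : Plaq A d) : ℝ :=
  ∫ U, plaqObs ρ e u U * plaqObs ρ e v U * ∏ q ∈ Q, plaqObs ρ e q U ∂(productHaar A d G)

/-- **Leading order of a pair term**:
`|T_Q(u,v) - β^{|Q|} M_Q(u,v)| ≤ N² 2^{|Q|} (βN)^{|Q|+1}` for `0 ≤ β`, `βN ≤ 1`. [folklore] -/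
theorem abs_pairT_sub_leading_le (hρ : Continuous ρ) (hβ : 0 ≤ β) (hβN : β * N ≤ 1)
    (Q : Finset (Plaq A d)) (u v : Plaq A d) :
    |pairT ρ e β Q u v - β ^ Q.card * leadM ρ e Q u v| ≤
      N ^ 2 * (2 ^ Q.card * (β * N) ^ (Q.card + 1)) := by
  classical
  haveI := isProbabilityMeasure_productHaar (A := A) (d := d) (G := G)
  have hpow : ∀ U : Config A d G, β ^ Q.card * ∏ q ∈ Q, plaqObs ρ e q U =
      ∏ q ∈ Q, β * plaqObs ρ e q U := fun U => by
    rw [prod_mul_distrib, prod_const]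
  have hcont : Continuous fun U : Config A d G =>
      plaqObs ρ e u U * plaqObs ρ e v U * ∏ q ∈ Q, plaqObs ρ e q U :=
    ((continuous_plaqObs ρ hρ e u).mul (continuous_plaqObs ρ hρ e v)).mul
      (continuous_finsetProd _ fun q _ => continuous_plaqObs ρ hρ e q)
  have hI2 : Integrable (fun U : Config A d G => β ^ Q.card *
      (plaqObs ρ e u U * plaqObs ρ e v U * ∏ q ∈ Q, plaqObs ρ e q U)) (productHaar A d G) :=
    (TwistedSlab.integrable_config_of_continuous hcont).const_mul _
  unfold pairT leadM
  rw [← integral_const_mul, ← integral_sub (TwistedSlab.integrable_config_of_continuous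
      (continuous_pairIntegrand ρ e β hρ _ _ _)) hI2]
  have hbd : ∀ U : Config A d G,
      ‖plaqObs ρ e u U * plaqObs ρ e v U * ∏ q ∈ Q, gfac ρ e β q U -
        β ^ Q.card * (plaqObs ρ e u U * plaqObs ρ e v U * ∏ q ∈ Q, plaqObs ρ e q U)‖ ≤
      N ^ 2 * (2 ^ Q.card * (β * N) ^ (Q.card + 1)) := fun U => by
    have hfold : β ^ Q.card * (plaqObs ρ e u U * plaqObs ρ e v U * ∏ q ∈ Q, plaqObs ρ e q U) =
        plaqObs ρ e u U * plaqObs ρ e v U * ∏ q ∈ Q, β * plaqObs ρ e q U := by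
      rw [← hpow]; ring
    rw [hfold, ← mul_sub, Real.norm_eq_abs, abs_mul, abs_mul]
    have hP := abs_plaqObs_le ρ hρ e u U
    have hQ' := abs_plaqObs_le ρ hρ e v U
    have hdiff := DiagRPSUN.abs_prod_add_sub_prod_le Q (fun q => β * plaqObs ρ e q U)
      (fun q => gfac ρ e β q U - β * plaqObs ρ e q U) (t := β * N) (by positivity) hβN
      (fun q _ => by
        rw [abs_mul, abs_of_nonneg hβ]
        exact mul_le_mul_of_nonneg_left (abs_plaqObs_le ρ hρ e _ U) hβ)
      (fun q _ => abs_gfac_sub_le ρ e β hρ hβ hβN _ U)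
    simp only [add_sub_cancel] at hdiff
    calc |plaqObs ρ e u U| * |plaqObs ρ e v U| *
          |∏ q ∈ Q, gfac ρ e β q U - ∏ q ∈ Q, β * plaqObs ρ e q U|
        ≤ N * N * (2 ^ Q.card * (β * N) ^ (Q.card + 1)) :=
          mul_le_mul (mul_le_mul hP hQ' (abs_nonneg _) (Nat.cast_nonneg _)) hdiff
            (abs_nonneg _) (by positivity)
      _ = N ^ 2 * (2 ^ Q.card * (β * N) ^ (Q.card + 1)) := by ring
  have h := norm_integral_le_of_norm_le_const (μ := productHaar A d G) (ae_of_all _ hbd)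
  rwa [probReal_univ, mul_one, Real.norm_eq_abs] at h

end Leading

end PairExp

end TiltedRP

end Summit.QuantumFields.GaugeBoot

end
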